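import Mathlib
import HarnessLib
import HarnessLib.Audit
import Summits.ValiantsHypothesis.Statement
import Literature.Computability.AlgebraicComplexity.VPDeterminantalQPProofs
import Literature.Computability.AlgebraicComplexity.ValiantConjectureProofs
import HarnessLib.Audit.Status.Attr

/-!
Route: RefutationDegree

DORMANT since 2026-08-23T10:41:41Z (reconciler: no traction for 6.1 d (last activity item-evidence-added at 2026-08-17T08:30:14Z); parked, not closed — `ledger route dormant route-ValiantsHypothesis-RefutationDegree --off` to reactivate) — unstaffed, not closed; items shared with open routes are served there. `ledger route dormant <id> --off` reactivates.

# Route RefutationDegree — refutation degree of determinantal representability of per_n — low SOS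
degree certifies dc beyond quasi-polynomial, high degree is a barrier

Write Rep(n,m) for the polynomial system "per_n(x) = det(A₀ + Σ_e x_e A_e) identically in x" in the
(n²+1)m² unknown entries of
A₀, A_e ∈ ℂ^(m×m) (its equations are the x-coefficients of the defect P = det(A(x)) − per_n(x));
Rep(n,m) is solvable iff
HasDetRepr per_n m, i.e. iff m ≥ dc(per_n). X = CertWindowQP ("it suffices to show"): there is an
exponent c' such that for every c
some n admits, for EVERY m ≤ 2^((log₂ n + c)^c), a Positivstellensatz (Hermitian sums-of-squares)
refutation of Rep(n,m) in which every
product has degree ≤ (m+2)^c'. In words: throughout the quasi-polynomial window the non-existence of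
size-m determinantal expressions
of the permanent is certified by duality certificates of degree polynomial in m — the refutation
degree D(n,m) of card
refutation-degree-dichotomy stays LOW. X is strictly stronger than the Extended Valiant Hypothesis
in dc-form (route DetQP's target):
soundness of the certificates turns X into ¬IsQPBounded (n ↦ dc(per_n)) and hence VP_ℂ ≠ VNP_ℂ.
Cards realised:
refutation-degree-dichotomy (spine: the object D(n,m), both horns), dual-certificates-dc3 (the n = 3
certificate computations = items
SmallCaseThreeFive / MrCalibration and the cheapest falsifier).
Lean: `∃ c' : ℕ, ∀ c : ℕ, ∃ n : ℕ, ∀ m ≤ 2 ^ ((Nat.log 2 n + c) ^ c), (let P : MvPolynomial (Fin n ×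
Fin n) (MvPolynomial (Option (Fin n × Fin n) × (Fin m × Fin m)) ℂ) := (Matrix.of fun i j : Fin m =>
MvPolynomial.C (MvPolynomial.X (none, (i, j))) + ∑ e : Fin n × Fin n, MvPolynomial.X e *
MvPolynomial.C (MvPolynomial.X (some e, (i, j))) : Matrix (Fin m) (Fin m) (MvPolynomial (Fin n × Fin
n) (MvPolynomial (Option (Fin n × Fin n) × (Fin m × Fin m)) ℂ))).det - MvPolynomial.map
MvPolynomial.C (Literature.Computability.AlgebraicComplexity.perPoly (Fin n) ℂ); let eqn : ((Fin n ×
Fin n) →₀ ℕ) → MvPolynomial ((Option (Fin n × Fin n) × (Fin m × Fin m)) ⊕ (Option (Fin n × Fin n) ×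
(Fin m × Fin m))) ℂ := fun μ => MvPolynomial.rename Sum.inl (P.coeff μ); let cj : MvPolynomial
((Option (Fin n × Fin n) × (Fin m × Fin m)) ⊕ (Option (Fin n × Fin n) × (Fin m × Fin m))) ℂ →
MvPolynomial ((Option (Fin n × Fin n) × (Fin m × Fin m)) ⊕ (Option (Fin n × Fin n) × (Fin m × Fin
m))) ℂ := fun p => MvPolynomial.rename Sum.swap (MvPolynomial.map (starRingEnd ℂ) p); ∃ (k : ℕ) (q :
Fin k → MvPolynomial ((Option (Fin n × Fin n) × (Fin m × Fin m)) ⊕ (Option (Fin n × Fin n) × (Fin m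
× Fin m))) ℂ) (h : ((Fin n × Fin n) →₀ ℕ) → MvPolynomial ((Option (Fin n × Fin n) × (Fin m × Fin m))
⊕ (Option (Fin n × Fin n) × (Fin m × Fin m))) ℂ), (∀ i, (q i * cj (q i)).totalDegree ≤ (m + 2) ^ c')
∧ (∀ μ, (h μ * eqn μ).totalDegree ≤ (m + 2) ^ c') ∧ ∑ i, q i * cj (q i) + ∑ μ ∈ P.support, (h μ *
eqn μ + cj (h μ * eqn μ)) + 1 = 0)`

## Assembly
Pure bookkeeping over PROVED Literature facts (no hypothesis is an unproved named fact): assume VP ℂ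
= VNP ℂ; then perFamily ℂ ∈ VP ℂ
(`perFamily_mem_VNP_holds`), so (fun n ↦ perPoly (Fin n) ℂ) is a VP family
(`mem_VP_ofFintype_iff_holds`), so n ↦ dc(per_n) is
quasi-polynomially bounded with some constant c
(`isQPBounded_determinantalComplexity_of_isVPFamily_holds`); CertWindowQP at this c gives n
with certificates for all m ≤ 2^((log₂ n + c)^c), in particular for m := dc(per_n); SosSound makes
HasDetRepr per_n (dc per_n) false,
contradicting attainment (`hasDetRepr_determinantalComplexity_holds`, Valiant universality).
Equivalently: SosSound + CertWindowQP ⇒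
DetQP.DetqpThesis ⇒ VH along route DetQP's assembly.

Rationale: WHY THIS LINE. Every known lower bound for dc(per_n) is secretly a bounded-degree algebraic
refutation of Rep(n,m): Mignon–Ressayre's n²/2
(MignonRessayre2004, proved in tree as
`Literature.Computability.AlgebraicComplexity.sq_le_two_mul_of_hasDetRepr_perPoly`) is the
identity "a nonzero (2m+1)-minor of Hess per_n(y₀) = Σ h_μ·eq_μ" of degree ≤ m(2m+1) (item
MrCalibration), and Grochow2015 reads all
known bounds as separating modules. The line imports PROOF COMPLEXITY
(Nullstellensatz/Positivstellensatz degree: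
BussImpagliazzoKrajicekPudlakRazborovSgall1997, Grigoriev2001, Razborov1998; symmetry reduction
GatermannParrilo2004; certificate
search DeloeraEtAl2011) and makes the refutation degree D(n,m) of the EXACT (non-border, unpadded)
system the object: the positive
horn is Mulmuley's flip (Mulmuley2011) realised by duality certificates whose positivity is supplied
by Artin–Stengle/SDP at fixed
degree instead of conjectured Kronecker positivity; the negative horn (RefutationBarrier) is the
algebraic analogue of Austrin–Risse's
theorem that SOS needs degree s^(1−ε) to refute "f has circuits of size s" for EVERY Boolean f
(AustrinRisse2023 Thm 1.1) — for
Rep(n,m), which has no wiring variables and no expansion structure, nothing of the kind is known,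
and a proof just above m = n²/2
would explain the twenty-year stall at the Hessian bound by covering every bounded-degree
identity-based argument (MR04, LMR13, ABV17
types) at one stroke. No prior route touches certificates: DetQP bets on a new hypersurface
invariant, GCTMult/IntegralGCT on
representation-theoretic obstructions in the padded orbit-closure world; the negatives index is
empty.

RANKED CRUXES. #0 CertWindowQP (target) — X as in § Thesis: ∃ c' ∀ c ∃ n ∀ m ≤ 2^((log₂ n + c)^c),
Rep(n,m) has a Hermitian-SOS (real Positivstellensatz) refutation with all products of degree ≤
(m+2)^c' (card item CertFamilyQP, SOS form). (why it might fail: Strictly stronger than EVH: needs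
dc(per_n) super-quasi-polynomial AND poly(m)-degree certificates (Kollar1988-type bounds allow
m^Θ(n²m²)); Grigoriev/Austrin–Risse-type degree lower bounds may hold for Rep; a closed form uniform
in the target polynomial is natural-proof-like (FSV18).) [Mulmuley2011, Grochow2015,
MignonRessayre2004, Grigoriev2001, Kollar1988, ForbesShpilkaVolk2018,
BurgisserClausenShokrollahi1997]
#2 BeyondHessianNs (crux) — one step past the Hessian bound, by identities: ∃ c n₀ ∀ n ≥ n₀, Rep(n,
⌊n²/2⌋+1) has a Nullstellensatz refutation 1 = Σ_μ h_μ·eq_μ with every product of degree ≤ n^c (the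
first instance of the positive horn in its strong, NS form; MR's certificate stops exactly at 2m+1 ≤
n²). [deps: MrCalibration] [difficulty: open-problem] (why it might fail: Fails if dc(per_n) ≤
n²/2+1 infinitely often (nothing excludes dc(per_n) = O(n²); only Grenet's 2^n−1 above), or if past
the Hessian range every refutation needs super-polynomial NS degree (the NS shadow of
RefutationBarrier); Landsberg2017 Rem 6.4.6.5: third-order data has not moved MR04.)
[MignonRessayre2004, LandsbergGCT2017, LandsbergManivelRessayre2013, AlperBogartVelasco2017,
BussImpagliazzoKrajicekPudlakRazborovSgall1997, Grenet2011]
#3 RefutationBarrier (crux) — the negative horn as a barrier theorem (does not presuppose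
infeasibility): for every c, for all large n and EVERY m ≥ ⌊n²/2⌋+1, Rep(n,m) has no Hermitian-SOS
refutation with products of degree ≤ n^c — bounded-degree (semi-)algebraic reasoning cannot exclude
determinantal expressions of the permanent of any size past the Hessian bound (card item NSBarrier,
in the stronger SOS form; its NS shadow follows via NsToSos). [difficulty: open-problem] (why it
might fail: Refuted by any MR-style argument one order up: a cubic-form/Gauss-map/singular-locus
invariant proving dc(per_n) ≥ n²/2+2 by identities of degree n^O(1) (LMR13, ABV17 have this shape);
no SOS degree lower bound is known for systems without Boolean/wiring variables (AustrinRisse2023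
needs expansion).) [AustrinRisse2023, Grigoriev2001, Razborov1998, GatermannParrilo2004,
MignonRessayre2004, AlperBogartVelasco2017]
#4 BeyondHessianSos (crux) — the weak positive step: ∃ c n₀ ∀ n ≥ n₀, Rep(n, ⌊n²/2⌋+1) has a
Hermitian-SOS refutation with products of degree ≤ n^c (implied by BeyondHessianNs; contradicts
RefutationBarrier; the natural home of compactness / moment-map (Kempf–Ness) arguments, which are
positivity arguments). [deps: BeyondHessianNs] [difficulty: XL] (why it might fail: Dies with
BeyondHessianNs if dc(per_n) ≤ n²/2+1 infinitely often, and dies if RefutationBarrier holds;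
positivity may buy nothing here: the known NS-vs-SOS degree separations (PHP: Razborov1998 vs
Grigoriev–Hirsch–Pasechnik) all run through Boolean axioms, absent in Rep(n,m).)
[GatermannParrilo2004, Grigoriev2001, Razborov1998, MignonRessayre2004, LandsbergRessayre2017]
#5 SmallCaseThreeFive (crux) — the first instance beyond the Hessian bound where infeasibility is
KNOWN (dc(per_3) = 7, ABV17): Rep(3,5) has a Nullstellensatz refutation with every product of degree
≤ 55 = m(2m+1), i.e. within the degree budget of the Mignon–Ressayre certificate at m = 5 (card
dual-certificates-dc3's computation, typed; degrees < 5 are impossible for grading reasons, see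
Numbers). [deps: MrCalibration] [difficulty: L] (why it might fail: ABV17's proof that Rep(3,5) is
infeasible is a dimension count on the singular locus, and counting is what costs degree in NS/PC
(Razborov1998, BIKPRS97); the minimal degree may exceed 55, and the search space (≥ binom(250+D,D)
columns before symmetry reduction) may defeat NulLA linear algebra.) [AlperBogartVelasco2017,
HuttenhainIkenmeyer2016, DeloeraEtAl2011, Razborov1998, GatermannParrilo2004]
#9 SosSound (support) — soundness of Hermitian-SOS refutations of Rep(n,m): if one exists (any
degree) then per_n has no affine determinantal representation of size m — evaluate the identity at
(a, conj a) for the entries a of a putative representation: Σ|q_i|² + 0 + 1 = 0 is absurd. Routine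
(MvPolynomial.eval, RingHom.map_det, totalDegree ≤ 1 ⇒ affine normal form of the entries).
[difficulty: provable-now] [Grigoriev2001, MignonRessayre2004]
#9 NsToSos (support) — a Nullstellensatz refutation of degree d is a Hermitian-SOS refutation of
degree d (take k = 0 squares and h' = −½·(h lifted to the holomorphic copy); the conjugation cj is a
ring map fixing 1). Links the two degree notions used by the route (D_SOS ≤ D_NS). [difficulty:
provable-now] [BussImpagliazzoKrajicekPudlakRazborovSgall1997, Grigoriev2001]
#9 MrCalibration (support) — the Mignon–Ressayre bound IS a low-degree refutation: for n ≥ 3 and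
2m+1 ≤ n², Rep(n,m) has a Nullstellensatz refutation of degree ≤ c(m+1)² (c = 3 expected: a
(2m+1)-minor of Hess(det∘A)(y₀) = LᵀHess(det)(A(y₀))L is, by Cauchy–Binet and primality of (det), a
multiple of det A(y₀) ≡ per(y₀) = 0, while it differs from the nonzero constant minor of Hess
per_n(y₀) by an element of the ideal; in tree: rank_hess0_det_le, rank_mrHess, eval_mrPoint_perPoly
in MignonRessayreBound.lean). Calibrates D(n,m) = O(m²) on the whole known range. [difficulty: L]
[MignonRessayre2004, LandsbergGCT2017, CaiChenLi2010]

TWO-LAYER PLAN. Foreseen glued splits (k ≤ 3, depth 1), none filed now: CertWindowQP ⇐ PolyWindow (∀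
k: certificates of degree poly(m) for all
m ≤ n^k, the VNP ⊄ VBP strength) → WindowLift (a closed-form certificate family read off from the
isotypic pattern, valid up to
2^polylog) → CertWindowQP; BeyondHessianNs ⇐ ThirdOrderIdentity (the cubic form of det_m on ker Hess
along the corank-1 stratum
restricts to rank defect on any n²-plane carrying per's third-order data) → DegreeBookkeeping →
BeyondHessianNs; RefutationBarrier ⇐
PseudoExpectation (a degree-n^c Hermitian-positive functional vanishing on the truncated ideal,
built from second-order jets of genuine
representations of nearby polynomials) → Gluing over m → RefutationBarrier. If NS degree proves
large but SOS small at n = 3, restate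
BeyondHessianNs in SOS form (route edit), not a new route.

KILL CRITERIA. RefutationBarrier PROVED ⇒ BeyondHessianSos, BeyondHessianNs and CertWindowQP are
false (Grenet forces the witnesses n of X to grow with
c, so the barrier bites): close `refuted:CertWindowQP`, keep RefutationBarrier's theorem as a new
catalogued barrier
(Literature/Barriers/ValiantsHypothesis) — the route then succeeded as a barrier route. A proof that
dc(per_n) ≤ 2^polylog(n) (¬DetqpThesis)
kills X and DetQP together. dc(per_n) ≤ n²/2+1 for infinitely many n kills cruxes 2 and 4 but not X
(pivot m ↦ first infeasible size).
SmallCaseThreeFive refuted (minimal degree at (3,5) > 55) does not close the route but flips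
staffing to the barrier horn (rank 3 ↔ 2).
DetqpThesis proved elsewhere by a non-certificate argument moots the positive horn's pay-off but not
RefutationBarrier.

NOT DECOMPOSED YET. The symmetry reduction (Gatermann–Parrilo block-diagonalisation by (S_n×S_n⋊ℤ/2
× torus) × GL_m×GL_m, normal form A₀ = diag(0,1,…,1)) is
infrastructure for whoever computes, not an item; the isotypic bookkeeping of certificates (which
modules carry them past n²/2) is data,
filed as evidence on SmallCaseThreeFive; the NS shadow of RefutationBarrier and the SOS form of the
target's polynomial-window rung are
layer-2; no item depends on a new definition (everything is inlined; see Definition requests for the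
clean-up). n = 4, m ∈ [9,14] is the
informative range for computation but no statement is filed until (3,5) is settled.

CHEAPEST FALSIFIER. Compute the minimal Nullstellensatz degree of Rep(3,4) (inside the MR range; MR
budget 36, trivial lower bound 4) and of Rep(3,5) (item
SmallCaseThreeFive; budget 55, lower bound 5) by symmetry-reduced linear algebra (NulLA,
DeloeraEtAl2011 + GatermannParrilo2004): if
already (3,4) needs degree near 36 and (3,5) exceeds 55 or is out of reach, the computational arm of
the positive horn is dead and staffing
flips to RefutationBarrier; if (3,5) closes at degree ≤ 10 with readable isotypic support, proceed
to (3,6) and (4,9). Not run here: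
by the grading remark in Numbers every certificate at (3,m) has degree ≥ m, so the dc3 card's
planned degrees D = 1,2,3 are vacuous and
the first meaningful linear system at (3,5) has ≥ binom(255,5) ≈ 8.8·10⁹ columns before reduction —
a kit job needing the equivariant
reduction first, not a planner-side check. Lookup done: no NS/SOS certificate computation for any dc
instance in zbMATH / frontier.

NUMBERS. Known: n²/2 ≤ dc(per_n) (MignonRessayre2004, in tree), dc(per_3) = 7
(AlperBogartVelasco2017), dc(per_n) ≤ 2^n − 1 (Grenet2011, in
tree). MR as a certificate: degree ≤ m(2m+1) for 2m+1 ≤ n² (MrCalibration; 36 at (3,4)). Grading: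
coeff_μ det(A(x)) is homogeneous of
degree m in the unknowns and nonzero for |μ| ≤ m, per's coefficients are constants, so every
refutation of Rep(n,m) has degree ≥ m once
m ≥ n and degree 0 if m < n: "low" means poly(m), and D(n,m) ∈ [m, 3(m+1)²] on the MR range. Sizes:
unknowns (n²+1)m² = 160/250/360 at
(3,4)/(3,5)/(3,6); equations = monomials of degree ≤ m in 9 variables = 715/2002/5005. Scale
comparison: AustrinRisse2023 Thm 1.1 /
Prop 1.1 give SOS degree Θ̃(s) for Circuit_s(f) (low = polylog there); generic upper bounds for Rep
are only Kollar1988-type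
m^O((n²+1)m²). Items at open: 9 (target, assembly, 4 cruxes, 3 support).

DEFINITION REQUESTS. Two Literature notions (topic Literature/Computability/MetaComplexity, next to
Resolution.lean), filed after open so a tenure pass can
shorten the inlined statements: HasNSRefutationOfDegree (for g : ι → MvPolynomial σ K over a field:
∃ h, Σ h i * g i = 1 with
totalDegree (h i * g i) ≤ d; BIKPRS97) and HasHermitianSosRefutationOfDegree (for g : ι →
MvPolynomial σ ℂ: the identity Σ q_j q_j* +
Σ (h_i g_i + (h_i g_i)*) + 1 = 0 in MvPolynomial (σ ⊕ σ) ℂ with * = conjugate coefficients ∘ swap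
copies, all products of degree ≤ d;
equivalent to a real Positivstellensatz refutation of the realification of the same degree,
Grigoriev2001), each with its soundness
lemma. No cite facts wanted: MR04, Grenet, universality, per ∈ VNP, VP ⇒ qp-bounded dc are all
proved in tree.

Novelty: Searches (2026-08-15): `lit search --source zbmath` ×8 ("sum of squares minimum circuit size Austrin
Risse" 1 hit = AustrinRisse2023;
"Positivstellensatz degree knapsack Grigoriev" 5; "symmetry groups semidefinite programs sums of
squares Gatermann Parrilo" 1;
"determinantal complexity permanent lower bound" 10: LR17, LMR13, Jansen, Bedi–Suagee 2026, no
certificate work; "Nullstellensatz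
refutation degree lower bounds" 4: BIKPRS97, Buresh-Oppenheim et al., Berkholz–Grohe
arXiv:1502.05912; "infeasibility certificates
combinatorial Nullstellensatz De Loera" 2); `lit frontier ValiantsHypothesis --since 2021` (30 rows:
PIT/IPS arXiv:2306.02184, border-dc
of power sums arXiv:2606.13628, nothing on certificate degree for dc); `lit bridges
ValiantsHypothesis --cross any` (generic textbooks);
`lit galaxy search "Nullstellensatz certificate determinantal complexity permanent" --star all`
(panama 0 hits; pdf/crabby saturated at
filing); `lit read arxiv:2311.12994` (Thm 1.1, Prop 1.1 read); openalex/s2/arxiv rate-limited at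
filing; tree: MignonRessayreBound.lean
read (MR04 formalised via rank_hess0_det_le).
Nearest prior art found: AustrinRisse2023 (SOS degree Ω(s^(1−ε)) for the Boolean MCSP system
Circuit_s(f), every f — the negative horn's
template, Boolean and expansion-based); DeloeraEtAl2011 + GatermannParrilo2004 (minimal-degree NS
certificates by linear algebra,
symmetry-reduced SOS — the servicing computation, graded `variant` on card dual-certificates-dc3);
Grochow2015 (known d  [refs: 1502.05912, 2306.02184, 2606.13628, 2311.12994, arxiv:2311.12994, AustrinRisse2023, DeloeraEtAl2011, GatermannParrilo2004, Grochow2015, Mulmuley2011, MignonRessayre2004, AlperBogartVelasco2017, HuttenhainIkenmeyer2016, GrochowPitassi2018]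

Barriers (technique_class: refutation-degree, sos-certificates, proof-complexity): - technique_class: refutation-degree, sos-certificates, proof-complexity
- Literature.Barriers.ValiantsHypothesis.AlgebraicNaturalProofs: (conditional:
SuccinctHittingSetsForVP → ¬NaturalProofAgainstVP) the route's certificates live in the pencil space
with per_n's coefficients substituted — instance refutations, the algebraic analogue of proofs of
Circuit_s(f) for one f, not distinguishers on coefficient space; it applies exactly when a
certificate family is UNIFORM in the target polynomial (eliminating the unknowns then yields a
distinguisher D(c) vanishing on dc ≤ m), which a closed form read off from isotypic patterns may
well be — conceded for that branch of CertWindowQP; RefutationBarrier is itself a barrier statement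
and immune.
- Literature.Barriers.ValiantsHypothesis.PartialDerivativesDetPerm: (flattening ranks agree on det
and per; same family: RankMethods EGOW18, RankLifting GMOW19, ShiftedPartialsCannotSeparate ELSW18,
all padded/border or tensor-rank classes) formally none of these meets the technique class —
Rep(n,m) is exact, affine, unpadded and its certificates are unconstrained in shape; but MR's
certificate (MrCalibration) IS a rank certificate (minors of a Hessian) and saturates at n²/2: the
bet of cruxes 2/4 is that minimal certificates past n²/2 are not minors of any flattening — the
route measures rather than assumes this, and these barriers predict which certificate shapes will
NOT be the low-degree ones.
- Literature.Barriers.ValiantsHypothesis.GCTOcc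

History (route lifecycle, newest last):
- 2026-08-16T04:21:46Z · AUTO-CRUX (backfill): CertWindowQP — hypotheses of the deciding theorem that nothing in the route derives are cruxes (operator:999:1085951)
- 2026-08-23T10:41:41Z · DORMANT — reconciler: no traction for 6.1 d (last activity item-evidence-added at 2026-08-17T08:30:14Z); parked, not closed — `ledger route dormant route-ValiantsHypothes (operator:999:1661692)

sub-problem: ValiantsHypothesis · status: dormant · opened planner-plancard-ValiantsHypothesis-ValiantsH-4bda9860-0 2026-08-15T11:41:57Z · rev 1 · ledger route-ValiantsHypothesis-RefutationDegree
GENERATED by the gate from the ledger (D-0016/17). Provers cite these decls: `theorem foo : Summit.ValiantsHypothesis.ValiantsHypothesis.Theses.RefutationDegree.<Decl> := …` in Summits/ValiantsHypothesis/ValiantsHypothesis/Theorems/<Name>.lean.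
-/

namespace Summit.ValiantsHypothesis.ValiantsHypothesis.Theses.RefutationDegree

open scoped BigOperators Topology Manifold Classical MeasureTheory ProbabilityTheory Matrix InnerProductSpace ComplexConjugate ContinuousMap
open Filter Set Function TopologicalSpace MeasureTheory

attribute [summit_statement] _root_.ValiantsHypothesis

open Literature.PNP

/-- item stmt-ValiantsHypothesis-5640 · crux (kind.auto-crux: conjecture-grade) · rank 0 · open · by planner
why it might fail: Strictly stronger than EVH: needs dc(per_n) super-quasi-polynomial AND poly(m)-degree certificates (Kollar1988-type bounds allow m^Θ(n²m²)); Grigoriev/Austrin–Risse-type degree lower bounds may hold for Rep; a closed form uniform in the target polynomial is natural-proof-like (FSV18).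
sources: Mulmuley2011, Grochow2015, MignonRessayre2004, Grigoriev2001, Kollar1988, ForbesShpilkaVolk2018
[target] X as in § Thesis: ∃ c' ∀ c ∃ n ∀ m ≤ 2^((log₂ n + c)^c), Rep(n,m) has a Hermitian-SOS (real
Positivstellensatz) refutation with all products of degree ≤ (m+2)^c' (card item CertFamilyQP, SOS
form). -/
@[route_item "route-ValiantsHypothesis-RefutationDegree", crux]
def CertWindowQP : Prop :=
  ∃ c' : ℕ, ∀ c : ℕ, ∃ n : ℕ, ∀ m ≤ 2 ^ ((Nat.log 2 n + c) ^ c), (let P : MvPolynomial (Fin n × Fin n) (MvPolynomial (Option (Fin n × Fin n) × (Fin m × Fin m)) ℂ) := (Matrix.of fun i j : Fin m => MvPolynomial.C (MvPolynomial.X (none, (i, j))) + ∑ e : Fin n × Fin n, MvPolynomial.X e * MvPolynomial.C (MvPolynomial.X (some e, (i, j))) : Matrix (Fin m) (Fin m) (MvPolynomial (Fin n × Fin n) (MvPolynomial (Option (Fin n × Fin n) × (Fin m × Fin m)) ℂ))).det - MvPolynomial.map MvPolynomial.C (Literature.Computability.AlgebraicComplexity.perPoly (Fin n) ℂ); let eqn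 : ((Fin n × Fin n) →₀ ℕ) → MvPolynomial ((Option (Fin n × Fin n) × (Fin m × Fin m)) ⊕ (Option (Fin n × Fin n) × (Fin m × Fin m))) ℂ := fun μ => MvPolynomial.rename Sum.inl (P.coeff μ); let cj : MvPolynomial ((Option (Fin n × Fin n) × (Fin m × Fin m)) ⊕ (Option (Fin n × Fin n) × (Fin m × Fin m))) ℂ → MvPolynomial ((Option (Fin n × Fin n) × (Fin m × Fin m)) ⊕ (Option (Fin n × Fin n) × (Fin m × Fin m))) ℂ := fun p => MvPolynomial.rename Sum.swap (MvPolynomial.map (starRingEnd ℂ) p); ∃ (k : ℕ) (q : Fin k → MvPolynomial ((Option (Fin n × Fin n) × (Fin m × Fin m)) ⊕ (Option (Fin n × Fin n) × (Fin m × Fin m))) ℂ) (h : ((Fin n × Fin n) →₀ ℕ) → MvPolynomial ((Option (Fin n × Fin n) × (Fin m × Fin m)) ⊕ (Option (Fin n × Fin n) × (Fin m × Fin m))) ℂ), (∀ i, (q i * cj (q i)).totalDegree ≤ (m + 2) ^ c') ∧ (∀ μ, (h μ * eqn μ).totalDegree ≤ (m + 2) ^ c') ∧ ∑ i, q i * cj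 (q i) + ∑ μ ∈ P.support, (h μ * eqn μ + cj (h μ * eqn μ)) + 1 = 0)

/-- item stmt-ValiantsHypothesis-5641 · crux · rank 2 · open · by planner
why it might fail: Fails if dc(per_n) ≤ n²/2+1 infinitely often (nothing excludes dc(per_n) = O(n²); only Grenet's 2^n−1 above), or if past the Hessian range every refutation needs super-polynomial NS degree (the NS shadow of RefutationBarrier); Landsberg2017 Rem 6.4.6.5: third-order data has not moved MR04.
sources: MignonRessayre2004, LandsbergGCT2017, LandsbergManivelRessayre2013, AlperBogartVelasco2017, BussImpagliazzoKrajicekPudlakRazborovSgall1997, Grenet2011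
[crux] one step past the Hessian bound, by identities: ∃ c n₀ ∀ n ≥ n₀, Rep(n, ⌊n²/2⌋+1) has a
Nullstellensatz refutation 1 = Σ_μ h_μ·eq_μ with every product of degree ≤ n^c (the first instance
of the positive horn in its strong, NS form; MR's certificate stops exactly at 2m+1 ≤ n²). [deps:
MrCalibration] [difficulty: open-problem] -/
@[route_item "route-ValiantsHypothesis-RefutationDegree", crux]
def BeyondHessianNs : Prop :=
  ∃ c n₀ : ℕ, ∀ n ≥ n₀, (let P : MvPolynomial (Fin n × Fin n) (MvPolynomial (Option (Fin n × Fin n) × (Fin (n ^ 2 / 2 + 1) × Fin (n ^ 2 / 2 + 1))) ℂ) := (Matrix.of fun i j : Fin (n ^ 2 / 2 + 1) => MvPolynomial.C (MvPolynomial.X (none, (i, j))) + ∑ e : Fin n × Fin n, MvPolynomial.X e * MvPolynomial.C (MvPolynomial.X (some e, (i, j))) : Matrix (Fin (n ^ 2 / 2 + 1)) (Fin (n ^ 2 / 2 + 1)) (MvPolynomial (Fin n × Fin n) (MvPolynomial (Option (Fin n × Fin n) × (Fin (n ^ 2 / 2 + 1) × Fin (n ^ 2 / 2 + 1))) ℂ))).det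 - MvPolynomial.map MvPolynomial.C (Literature.Computability.AlgebraicComplexity.perPoly (Fin n) ℂ); ∃ h : ((Fin n × Fin n) →₀ ℕ) → MvPolynomial (Option (Fin n × Fin n) × (Fin (n ^ 2 / 2 + 1) × Fin (n ^ 2 / 2 + 1))) ℂ, (∀ μ, (h μ * P.coeff μ).totalDegree ≤ n ^ c) ∧ ∑ μ ∈ P.support, h μ * P.coeff μ = 1)

/-- item stmt-ValiantsHypothesis-5642 · crux · rank 3 · open · by planner
why it might fail: Refuted by any MR-style argument one order up: a cubic-form/Gauss-map/singular-locus invariant proving dc(per_n) ≥ n²/2+2 by identities of degree n^O(1) (LMR13, ABV17 have this shape); no SOS degree lower bound is known for systems without Boolean/wiring variables (AustrinRisse2023 needs expansion).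
sources: AustrinRisse2023, Grigoriev2001, Razborov1998, GatermannParrilo2004, MignonRessayre2004, AlperBogartVelasco2017
[crux] the negative horn as a barrier theorem (does not presuppose infeasibility): for every c, for
all large n and EVERY m ≥ ⌊n²/2⌋+1, Rep(n,m) has no Hermitian-SOS refutation with products of degree
≤ n^c — bounded-degree (semi-)algebraic reasoning cannot exclude determinantal expressions of the
permanent of any size past the Hessian bound (card item NSBarrier, in the stronger SOS form; its NS
shadow follows via NsToSos). [difficulty: open-problem] -/
@[route_item "route-ValiantsHypothesis-RefutationDegree"]
def RefutationBarrier : Prop :=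
  ∀ c : ℕ, ∃ n₀ : ℕ, ∀ n ≥ n₀, ∀ m : ℕ, n ^ 2 / 2 + 1 ≤ m → ¬ (let P : MvPolynomial (Fin n × Fin n) (MvPolynomial (Option (Fin n × Fin n) × (Fin m × Fin m)) ℂ) := (Matrix.of fun i j : Fin m => MvPolynomial.C (MvPolynomial.X (none, (i, j))) + ∑ e : Fin n × Fin n, MvPolynomial.X e * MvPolynomial.C (MvPolynomial.X (some e, (i, j))) : Matrix (Fin m) (Fin m) (MvPolynomial (Fin n × Fin n) (MvPolynomial (Option (Fin n × Fin n) × (Fin m × Fin m)) ℂ))).det - MvPolynomial.map MvPolynomial.C (Literature.Computability.AlgebraicComplexity.perPoly (Fin n) ℂ); let eqn : ((Fin n × Fin n) →₀ ℕ) → MvPolynomial ((Option (Fin n × Fin n) × (Fin m × Fin m)) ⊕ (Option (Fin n × Fin n) × (Fin m × Fin m))) ℂ := fun μ => MvPolynomial.rename Sum.inl (P.coeff μ); let cj : MvPolynomial ((Option (Fin n × Fin n) × (Fin m × Fin m)) ⊕ (Option (Fin n × Fin n) × (Fin m × Fin m))) ℂ → MvPolynomial ((Option (Fin n × Fin n)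 × (Fin m × Fin m)) ⊕ (Option (Fin n × Fin n) × (Fin m × Fin m))) ℂ := fun p => MvPolynomial.rename Sum.swap (MvPolynomial.map (starRingEnd ℂ) p); ∃ (k : ℕ) (q : Fin k → MvPolynomial ((Option (Fin n × Fin n) × (Fin m × Fin m)) ⊕ (Option (Fin n × Fin n) × (Fin m × Fin m))) ℂ) (h : ((Fin n × Fin n) →₀ ℕ) → MvPolynomial ((Option (Fin n × Fin n) × (Fin m × Fin m)) ⊕ (Option (Fin n × Fin n) × (Fin m × Fin m))) ℂ), (∀ i, (q i * cj (q i)).totalDegree ≤ n ^ c) ∧ (∀ μ, (h μ * eqn μ).totalDegree ≤ n ^ c) ∧ ∑ i, q i * cj (q i) + ∑ μ ∈ P.support, (h μ * eqn μ + cj (h μ * eqn μ)) + 1 = 0)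

/-- item stmt-ValiantsHypothesis-5643 · crux · rank 4 · open · by planner
why it might fail: Dies with BeyondHessianNs if dc(per_n) ≤ n²/2+1 infinitely often, and dies if RefutationBarrier holds; positivity may buy nothing here: the known NS-vs-SOS degree separations (PHP: Razborov1998 vs Grigoriev–Hirsch–Pasechnik) all run through Boolean axioms, absent in Rep(n,m).
sources: GatermannParrilo2004, Grigoriev2001, Razborov1998, MignonRessayre2004, LandsbergRessayre2017
[crux] the weak positive step: ∃ c n₀ ∀ n ≥ n₀, Rep(n, ⌊n²/2⌋+1) has a Hermitian-SOS refutation with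
products of degree ≤ n^c (implied by BeyondHessianNs; contradicts RefutationBarrier; the natural
home of compactness / moment-map (Kempf–Ness) arguments, which are positivity arguments). [deps:
BeyondHessianNs] [difficulty: XL] -/
@[route_item "route-ValiantsHypothesis-RefutationDegree"]
def BeyondHessianSos : Prop :=
  ∃ c n₀ : ℕ, ∀ n ≥ n₀, (let P : MvPolynomial (Fin n × Fin n) (MvPolynomial (Option (Fin n × Fin n) × (Fin (n ^ 2 / 2 + 1) × Fin (n ^ 2 / 2 + 1))) ℂ) := (Matrix.of fun i j : Fin (n ^ 2 / 2 + 1) => MvPolynomial.C (MvPolynomial.X (none, (i, j))) + ∑ e : Fin n × Fin n, MvPolynomial.X e * MvPolynomial.C (MvPolynomial.X (some e, (i, j))) : Matrix (Fin (n ^ 2 / 2 + 1)) (Fin (n ^ 2 / 2 + 1)) (MvPolynomial (Fin n × Fin n) (MvPolynomial (Option (Fin n × Fin n) × (Fin (n ^ 2 / 2 + 1) × Fin (n ^ 2 / 2 + 1))) ℂ))).det - MvPolynomial.map MvPolynomial.C (Literature.Computability.AlgebraicComplexity.perPoly (Fin n) ℂ); let eqn : ((Fin n × Fin n) →₀ ℕ)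 → MvPolynomial ((Option (Fin n × Fin n) × (Fin (n ^ 2 / 2 + 1) × Fin (n ^ 2 / 2 + 1))) ⊕ (Option (Fin n × Fin n) × (Fin (n ^ 2 / 2 + 1) × Fin (n ^ 2 / 2 + 1)))) ℂ := fun μ => MvPolynomial.rename Sum.inl (P.coeff μ); let cj : MvPolynomial ((Option (Fin n × Fin n) × (Fin (n ^ 2 / 2 + 1) × Fin (n ^ 2 / 2 + 1))) ⊕ (Option (Fin n × Fin n) × (Fin (n ^ 2 / 2 + 1) × Fin (n ^ 2 / 2 + 1)))) ℂ → MvPolynomial ((Option (Fin n × Fin n) × (Fin (n ^ 2 / 2 + 1) × Fin (n ^ 2 / 2 + 1))) ⊕ (Option (Fin n × Fin n) × (Fin (n ^ 2 / 2 + 1) × Fin (n ^ 2 / 2 + 1)))) ℂ := fun p => MvPolynomial.rename Sum.swap (MvPolynomial.map (starRingEnd ℂ) p); ∃ (k : ℕ) (q : Fin k → MvPolynomial ((Option (Fin n × Fin n) × (Fin (n ^ 2 / 2 + 1) × Fin (n ^ 2 / 2 + 1))) ⊕ (Option (Fin n × Fin n) × (Fin (n ^ 2 / 2 + 1) × Fin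 (n ^ 2 / 2 + 1)))) ℂ) (h : ((Fin n × Fin n) →₀ ℕ) → MvPolynomial ((Option (Fin n × Fin n) × (Fin (n ^ 2 / 2 + 1) × Fin (n ^ 2 / 2 + 1))) ⊕ (Option (Fin n × Fin n) × (Fin (n ^ 2 / 2 + 1) × Fin (n ^ 2 / 2 + 1)))) ℂ), (∀ i, (q i * cj (q i)).totalDegree ≤ n ^ c) ∧ (∀ μ, (h μ * eqn μ).totalDegree ≤ n ^ c) ∧ ∑ i, q i * cj (q i) + ∑ μ ∈ P.support, (h μ * eqn μ + cj (h μ * eqn μ)) + 1 = 0)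

/-- item stmt-ValiantsHypothesis-5644 · crux · rank 5 · open · by planner
why it might fail: ABV17's proof that Rep(3,5) is infeasible is a dimension count on the singular locus, and counting is what costs degree in NS/PC (Razborov1998, BIKPRS97); the minimal degree may exceed 55, and the search space (≥ binom(250+D,D) columns before symmetry reduction) may defeat NulLA linear algebra.
sources: AlperBogartVelasco2017, HuttenhainIkenmeyer2016, DeloeraEtAl2011, Razborov1998, GatermannParrilo2004
[crux] the first instance beyond the Hessian bound where infeasibility is KNOWN (dc(per_3) = 7,
ABV17): Rep(3,5) has a Nullstellensatz refutation with every product of degree ≤ 55 = m(2m+1), i.e.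
within the degree budget of the Mignon–Ressayre certificate at m = 5 (card dual-certificates-dc3's
computation, typed; degrees < 5 are impossible for grading reasons, see Numbers). [deps:
MrCalibration] [difficulty: L] -/
@[route_item "route-ValiantsHypothesis-RefutationDegree"]
def SmallCaseThreeFive : Prop :=
  (let P : MvPolynomial (Fin 3 × Fin 3) (MvPolynomial (Option (Fin 3 × Fin 3) × (Fin 5 × Fin 5)) ℂ) := (Matrix.of fun i j : Fin 5 => MvPolynomial.C (MvPolynomial.X (none, (i, j))) + ∑ e : Fin 3 × Fin 3, MvPolynomial.X e * MvPolynomial.C (MvPolynomial.X (some e, (i, j))) : Matrix (Fin 5) (Fin 5) (MvPolynomial (Fin 3 × Fin 3) (MvPolynomial (Option (Fin 3 × Fin 3) × (Fin 5 × Fin 5)) ℂ))).det - MvPolynomial.map MvPolynomial.C (Literature.Computability.AlgebraicComplexity.perPoly (Fin 3) ℂ); ∃ h : ((Fin 3 × Fin 3) →₀ ℕ) → MvPolynomial (Option (Fin 3 × Fin 3) × (Fin 5 × Fin 5)) ℂ, (∀ μ, (h μ * P.coeff μ).totalDegree ≤ 55) ∧ ∑ μ ∈ P.support, h μ * P.coeff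 μ = 1)

/-- item stmt-ValiantsHypothesis-5645 · support · rank 9 · closed · proved by Summit.ValiantsHypothesis.ValiantsHypothesis.Theorems.sosSound_proof @ 376347898b60 (prover) · by planner
sources: Grigoriev2001, MignonRessayre2004
[support] soundness of Hermitian-SOS refutations of Rep(n,m): if one exists (any degree) then per_n
has no affine determinantal representation of size m — evaluate the identity at (a, conj a) for the
entries a of a putative representation: Σ|q_i|² + 0 + 1 = 0 is absurd. Routine (MvPolynomial.eval,
RingHom.map_det, totalDegree ≤ 1 ⇒ affine normal form of the entries). [difficulty: provable-now] -/
@[route_item "route-ValiantsHypothesis-RefutationDegree", crux]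
def SosSound : Prop :=
  ∀ n m d : ℕ, (let P : MvPolynomial (Fin n × Fin n) (MvPolynomial (Option (Fin n × Fin n) × (Fin m × Fin m)) ℂ) := (Matrix.of fun i j : Fin m => MvPolynomial.C (MvPolynomial.X (none, (i, j))) + ∑ e : Fin n × Fin n, MvPolynomial.X e * MvPolynomial.C (MvPolynomial.X (some e, (i, j))) : Matrix (Fin m) (Fin m) (MvPolynomial (Fin n × Fin n) (MvPolynomial (Option (Fin n × Fin n) × (Fin m × Fin m)) ℂ))).det - MvPolynomial.map MvPolynomial.C (Literature.Computability.AlgebraicComplexity.perPoly (Fin n) ℂ); let eqn : ((Fin n × Fin n) →₀ ℕ) → MvPolynomial ((Option (Fin n × Fin n) × (Fin m × Fin m)) ⊕ (Option (Fin n × Fin n) × (Fin m × Fin m))) ℂ := fun μ => MvPolynomial.rename Sum.inl (P.coeff μ); let cj : MvPolynomial ((Option (Fin n × Fin n) × (Fin m × Fin m)) ⊕ (Option (Fin n × Fin n) × (Fin m × Fin m))) ℂ → MvPolynomial ((Option (Fin n × Fin n) × (Fin m × Fin m)) ⊕ (Option (Fin n × Fin n) × (Fin m × Fin m))) ℂ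 := fun p => MvPolynomial.rename Sum.swap (MvPolynomial.map (starRingEnd ℂ) p); ∃ (k : ℕ) (q : Fin k → MvPolynomial ((Option (Fin n × Fin n) × (Fin m × Fin m)) ⊕ (Option (Fin n × Fin n) × (Fin m × Fin m))) ℂ) (h : ((Fin n × Fin n) →₀ ℕ) → MvPolynomial ((Option (Fin n × Fin n) × (Fin m × Fin m)) ⊕ (Option (Fin n × Fin n) × (Fin m × Fin m))) ℂ), (∀ i, (q i * cj (q i)).totalDegree ≤ d) ∧ (∀ μ, (h μ * eqn μ).totalDegree ≤ d) ∧ ∑ i, q i * cj (q i) + ∑ μ ∈ P.support, (h μ * eqn μ + cj (h μ * eqn μ)) + 1 = 0) → ¬ Literature.Computability.AlgebraicComplexity.HasDetRepr (Literature.Computability.AlgebraicComplexity.perPoly (Fin n) ℂ) m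

/-- item stmt-ValiantsHypothesis-5646 · support · rank 9 · closed · proved by Summit.ValiantsHypothesis.ValiantsHypothesis.Theorems.nsToSos_proof @ 69d65b45e716 (prover) · by planner
sources: BussImpagliazzoKrajicekPudlakRazborovSgall1997, Grigoriev2001
[support] a Nullstellensatz refutation of degree d is a Hermitian-SOS refutation of degree d (take k
= 0 squares and h' = −½·(h lifted to the holomorphic copy); the conjugation cj is a ring map fixing
1). Links the two degree notions used by the route (D_SOS ≤ D_NS). [difficulty: provable-now] -/
@[route_item "route-ValiantsHypothesis-RefutationDegree"]
def NsToSos : Prop :=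
  ∀ n m d : ℕ, (let P : MvPolynomial (Fin n × Fin n) (MvPolynomial (Option (Fin n × Fin n) × (Fin m × Fin m)) ℂ) := (Matrix.of fun i j : Fin m => MvPolynomial.C (MvPolynomial.X (none, (i, j))) + ∑ e : Fin n × Fin n, MvPolynomial.X e * MvPolynomial.C (MvPolynomial.X (some e, (i, j))) : Matrix (Fin m) (Fin m) (MvPolynomial (Fin n × Fin n) (MvPolynomial (Option (Fin n × Fin n) × (Fin m × Fin m)) ℂ))).det - MvPolynomial.map MvPolynomial.C (Literature.Computability.AlgebraicComplexity.perPoly (Fin n) ℂ); ∃ h : ((Fin n × Fin n) →₀ ℕ) → MvPolynomial (Option (Fin n × Fin n) × (Fin m × Fin m)) ℂ, (∀ μ, (h μ * P.coeff μ).totalDegree ≤ d) ∧ ∑ μ ∈ P.support, h μ * P.coeff μ = 1) → (let P : MvPolynomial (Fin n × Fin n) (MvPolynomial (Option (Fin n × Fin n) × (Fin m × Fin m)) ℂ) := (Matrix.of fun i j : Fin m => MvPolynomial.C (MvPolynomial.X (none, (i, j))) + ∑ e : Fin n × Fin n, MvPolynomial.X e * MvPolynomial.C (MvPolynomial.X (some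 e, (i, j))) : Matrix (Fin m) (Fin m) (MvPolynomial (Fin n × Fin n) (MvPolynomial (Option (Fin n × Fin n) × (Fin m × Fin m)) ℂ))).det - MvPolynomial.map MvPolynomial.C (Literature.Computability.AlgebraicComplexity.perPoly (Fin n) ℂ); let eqn : ((Fin n × Fin n) →₀ ℕ) → MvPolynomial ((Option (Fin n × Fin n) × (Fin m × Fin m)) ⊕ (Option (Fin n × Fin n) × (Fin m × Fin m))) ℂ := fun μ => MvPolynomial.rename Sum.inl (P.coeff μ); let cj : MvPolynomial ((Option (Fin n × Fin n) × (Fin m × Fin m)) ⊕ (Option (Fin n × Fin n) × (Fin m × Fin m))) ℂ → MvPolynomial ((Option (Fin n × Fin n) × (Fin m × Fin m)) ⊕ (Option (Fin n × Fin n) × (Fin m × Fin m))) ℂ := fun p => MvPolynomial.rename Sum.swap (MvPolynomial.map (starRingEnd ℂ) p); ∃ (k : ℕ) (q : Fin k → MvPolynomial ((Option (Fin n × Fin n) × (Fin m × Fin m)) ⊕ (Option (Fin n × Fin n) × (Fin m × Fin m))) ℂ) (h : ((Fin n × Fin n) →₀ ℕ) → MvPolynomial ((Option (Fin n × Fin n)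 × (Fin m × Fin m)) ⊕ (Option (Fin n × Fin n) × (Fin m × Fin m))) ℂ), (∀ i, (q i * cj (q i)).totalDegree ≤ d) ∧ (∀ μ, (h μ * eqn μ).totalDegree ≤ d) ∧ ∑ i, q i * cj (q i) + ∑ μ ∈ P.support, (h μ * eqn μ + cj (h μ * eqn μ)) + 1 = 0)

/-- item stmt-ValiantsHypothesis-5647 · support · rank 9 · closed · proved by Summit.ValiantsHypothesis.ValiantsHypothesis.Theorems.mrCalibration_proof @ 9860e8d0d157 (prover) · by planner
sources: MignonRessayre2004, LandsbergGCT2017, CaiChenLi2010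
[support] the Mignon–Ressayre bound IS a low-degree refutation: for n ≥ 3 and 2m+1 ≤ n², Rep(n,m)
has a Nullstellensatz refutation of degree ≤ c(m+1)² (c = 3 expected: a (2m+1)-minor of
Hess(det∘A)(y₀) = LᵀHess(det)(A(y₀))L is, by Cauchy–Binet and primality of (det), a multiple of det
A(y₀) ≡ per(y₀) = 0, while it differs from the nonzero constant minor of Hess per_n(y₀) by an
element of the ideal; in tree: rank_hess0_det_le, rank_mrHess, eval_mrPoint_perPoly in
MignonRessayreBound.lean). Calibrates D(n,m) = O(m²) on the whole known range. [difficulty: L] -/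
@[route_item "route-ValiantsHypothesis-RefutationDegree"]
def MrCalibration : Prop :=
  ∃ c : ℕ, ∀ n m : ℕ, 3 ≤ n → 2 * m + 1 ≤ n ^ 2 → (let P : MvPolynomial (Fin n × Fin n) (MvPolynomial (Option (Fin n × Fin n) × (Fin m × Fin m)) ℂ) := (Matrix.of fun i j : Fin m => MvPolynomial.C (MvPolynomial.X (none, (i, j))) + ∑ e : Fin n × Fin n, MvPolynomial.X e * MvPolynomial.C (MvPolynomial.X (some e, (i, j))) : Matrix (Fin m) (Fin m) (MvPolynomial (Fin n × Fin n) (MvPolynomial (Option (Fin n × Fin n) × (Fin m × Fin m)) ℂ))).det - MvPolynomial.map MvPolynomial.C (Literature.Computability.AlgebraicComplexity.perPoly (Fin n) ℂ); ∃ h : ((Fin n × Fin n) →₀ ℕ) → MvPolynomial (Option (Fin n × Fin n) × (Fin m × Fin m)) ℂ, (∀ μ, (h μ * P.coeff μ).totalDegree ≤ c * (m + 1) ^ 2) ∧ ∑ μ ∈ P.support, h μ * P.coeff μ = 1)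

/-- item stmt-ValiantsHypothesis-5648 · assembly · rank 1 · closed · proved by Summit.ValiantsHypothesis.Theorems.RefutationDegree.assembly_proof @ 4afd4ac02be0 (prover) · by planner
sources: Valiant1979, BurgisserClausenShokrollahi1997, MignonRessayre2004
[assembly] SosSound → CertWindowQP → ValiantsHypothesis. -/
@[route_item "route-ValiantsHypothesis-RefutationDegree"]
def Assembly : Prop :=
  SosSound → CertWindowQP → ValiantsHypothesis

/-! D-0027 §2.1 — DECIDING THEOREM (planner-authored via `route open/edit --closes-file`; by planner-rbadge-ValiantsHypothesis-RefutationDe-213a892a-g2-0 2026-08-15T16:18:53Z):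
its hypotheses are this route's items and its conclusion the sub-problem Statement (glue_lint), and it elaborates with this file. -/

/-- D-0027 §2.1 deciding result of route RefutationDegree. Only the target `CertWindowQP` and
the soundness support item `SosSound` are load-bearing; everything else is PROVED Literature
(no unproved named fact is a hypothesis): assume `VP ℂ = VNP ℂ`; Valiant's `perFamily_mem_VNP_holds ℂ`
and the renaming bridge `mem_VP_ofFintype_iff_holds` make `(per_n)_n` a VP family; by
`isQPBounded_determinantalComplexity_of_isVPFamily_holds` (BCS97 Cor. 21.40) `n ↦ dc(per_n)` is
quasi-polynomially bounded with some constant `c`; `CertWindowQP` at this `c` gives an `n` with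
Hermitian-SOS refutations of Rep(n,m) for every `m ≤ 2^((log₂ n + c)^c)`, in particular for
`m := dc(per_n)`; `SosSound` turns that certificate into `¬ HasDetRepr per_n (dc per_n)`, contradicting
attainment `hasDetRepr_determinantalComplexity_holds` (Valiant universality). -/
@[closes "route-ValiantsHypothesis-RefutationDegree"] theorem closes (h_SosSound : SosSound) (h_CertWindowQP : CertWindowQP) : _root_.ValiantsHypothesis := by
  classical
  show Literature.Computability.AlgebraicComplexity.VP ℂ ≠ Literature.Computability.AlgebraicComplexity.VNP ℂ
  intro hEq
  -- per ∈ VNP (Valiant), hence per ∈ VP under the assumption, hence (per_n)_n is a VP family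
  have hVNP : Literature.Computability.AlgebraicComplexity.perFamily ℂ ∈
      Literature.Computability.AlgebraicComplexity.VNP ℂ :=
    Literature.Computability.AlgebraicComplexity.perFamily_mem_VNP_holds ℂ
  have hVP : Literature.Computability.AlgebraicComplexity.perFamily ℂ ∈
      Literature.Computability.AlgebraicComplexity.VP ℂ := by
    rw [hEq]; exact hVNP
  have hfam : Literature.Computability.AlgebraicComplexity.IsVPFamily
      (fun n => Literature.Computability.AlgebraicComplexity.perPoly (Fin n) ℂ) :=
    (Literature.Computability.AlgebraicComplexity.mem_VP_ofFintype_iff_holds _).1 hVP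
  -- VP families have quasi-polynomially bounded determinantal complexity (BCS97 Cor. 21.40)
  have hQP : Literature.Computability.AlgebraicComplexity.IsQPBounded
      (fun n => Literature.Computability.AlgebraicComplexity.determinantalComplexity
        (Literature.Computability.AlgebraicComplexity.perPoly (Fin n) ℂ)) :=
    Literature.Computability.AlgebraicComplexity.isQPBounded_determinantalComplexity_of_isVPFamily_holds
      _ hfam
  obtain ⟨c, hc⟩ := hQP
  -- the certificate window at this constant c
  obtain ⟨c', hX⟩ := h_CertWindowQP
  obtain ⟨n, hn⟩ := hX c
  have hcert := hn
    (Literature.Computability.AlgebraicComplexity.determinantalComplexity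
      (Literature.Computability.AlgebraicComplexity.perPoly (Fin n) ℂ)) (hc n)
  -- soundness: a certificate at m = dc(per_n) excludes a size-dc(per_n) representation …
  have hnot := h_SosSound n
    (Literature.Computability.AlgebraicComplexity.determinantalComplexity
      (Literature.Computability.AlgebraicComplexity.perPoly (Fin n) ℂ))
    ((Literature.Computability.AlgebraicComplexity.determinantalComplexity
      (Literature.Computability.AlgebraicComplexity.perPoly (Fin n) ℂ) + 2) ^ c') hcert
  -- … which exists by attainment of dc (Valiant universality)
  exact hnot (Literature.Computability.AlgebraicComplexity.hasDetRepr_determinantalComplexity_holds _)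

end Summit.ValiantsHypothesis.ValiantsHypothesis.Theses.RefutationDegree
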